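import Summits.HodgeConjecture.HodgeConjecture.Theorems.EightfoldBlochSeedsDefs
import Literature.AlgebraicGeometry.HodgeTheory.WeilFamilyPeriodConstructionAtWeilType
import Literature.AlgebraicGeometry.HodgeTheory.WeilFamilyReachSimilarOfConstruction
import Literature.AlgebraicGeometry.HodgeTheory.WeilFamilyReachSimilarOfMonodromy
import Literature.AlgebraicGeometry.HodgeTheory.HolomorphicBundleChernCharacterProjectiveSpace
import Literature.AlgebraicGeometry.HodgeTheory.AlgebraicClassesHodgeTypeHolds
import Literature.AlgebraicGeometry.HodgeTheory.WeilClassesRationalPlane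
import Literature.AlgebraicGeometry.HodgeTheory.WeilTypeAbelianVariety
import HarnessLib

/-!
# Route `EightfoldBlochSeeds`, crux `ReachHyperbolic` (item stmt-HodgeConjecture-18883), line `moduli-riemann`
# (`Cruxes/ReachHyperbolic/Lines/moduli_riemann.lean` 1ba65e5152037605): the remaining stub's statement `ModuliCompletePackage`
# (and the full `PeriodPackage`) FOLLOW FROM the one named Literature fact (J1) `deligne1982_weilFamily_periodConstructionAtWeilType`

HONEST FRAMING. CONDITIONAL results: hypothesis = the named, printed, UNPROVED Literature fact
`Literature.AlgebraicGeometry.HodgeTheory.deligne1982_weilFamily_periodConstructionAtWeilType` («(J1)»: Deligne's level-`n'` family through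
every polarised abelian `2n`-fold of Weil type with global `√-d`, integral level structure, period surjectivity and a polarisation class;
[Deligne1982HodgeCycles] proof of Thm. 4.8, [vanGeemen1994HodgeAV] 5.3–5.11, [MumfordFogartyKirwan1994] Thm. 7.9–7.10; no moduli of abelian
varieties in the tree). Nothing here proves `stub_moduliComplete`, the crux, rung H2, HC_AV or HC; no definition, no new named fact (D-0026);
census-neutral.

WHAT IS HERE (leafhand `leafhand-hodge-eightfoldblochseed-3-g0`). The registered stub `stub_moduliComplete : ModuliCompletePackage`
(`Theorems.EightfoldBlochSeeds.ModuliCompletePackage`, VERBATIM the skeleton's; `EightfoldBlochSeedsDefs.lean` §2) asks for a polarized Weil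
system with FLAT `(n,n)` WEIL-VALUED SECTIONS through every Weil class of `P` — a clause (J1) does not state. It is DERIVED here from (J1)'s
global endomorphism `g` and level structure by the tree's chain (the one used for `Theorems.SplitImpliesAllNonsplitCellsConnectedOfJ1.cellSystemReachAt_of_J1`):
balanced charts `balancedCharts_of_constructionAt` ([Deligne1982HodgeCycles] Prop. 4.4) ▸ special-unitary monodromy
`unitaryMonodromy_of_levelStructureAt` (`Γ ⊂ SU`, p. 50) ▸ flat sections `flatWeilSections_of_unitaryMonodromyAt` ([VoisinHodgeII2003] Lemma 4.17);
the polarisation class is `H := (ι ≫ pr₁)^* a'`, fibrewise rational of type `(1,1)` (`algebraicClasses_projectiveSpace_eq_top`,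
`isOfHodgeType_of_mem_algebraicClasses_of_isSmoothProjective`); period surjectivity [U] is verbatim (J1)'s.

* `periodPackage_of_deligne1982_weilFamily_periodConstructionAtWeilType : (J1) → PeriodPackage`;
* `moduliCompletePackage_of_deligne1982_weilFamily_periodConstructionAtWeilType : (J1) → ModuliCompletePackage` — **the stub is AT MOST (J1)**:
  together with `Theorems.moduliCompletePackage_iff_periodPackage` / `reachHyperbolic_of_moduliCompletePackage`
  (`EightfoldBlochSeedsReachHyperbolicOfModuliComplete.lean`) the line's ledger reads: `stub_moduliComplete ⟺ PeriodPackage ⟸ (J1)`, and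
  `stub_moduliComplete ⟹ ReachHyperbolic` by name; the item's honest status is `blocked-on: deligne1982_weilFamily_periodConstructionAtWeilType`
  (as for the direct conditional closure `Theorems.reachHyperbolic_of_deligne1982_weilFamily_periodConstructionAtWeilType`, p817303).

[cite: Deligne1982HodgeCycles, §4 Prop. 4.4 and proof of Thm. 4.8 (pp. 47–52)] [cite: vanGeemen1994HodgeAV, Lemma 5.2, 5.3–5.5 and 5.8–5.11]
[cite: VoisinHodgeII2003, Lemma 4.17] [cite: MumfordFogartyKirwan1994, Thm. 7.9–7.10]
-/

noncomputable section

-- single-problem summit (Problem = Summit): the mandated namespace repeats `HodgeConjecture`.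
set_option linter.dupNamespace false

open CategoryTheory AlgebraicGeometry
open scoped TensorProduct
open Literature.AlgebraicGeometry Literature.AlgebraicGeometry.Motives Literature.AlgebraicGeometry.HodgeTheory
open Literature.AlgebraicTopology.SingularHomology
open Summit.HodgeConjecture.HodgeConjecture.Theorems.EightfoldBlochSeeds

namespace Summit.HodgeConjecture.HodgeConjecture.Theorems

/-- **(J1) ⟹ the period-surjective package.** Deligne's period construction at Weil-type points
(`deligne1982_weilFamily_periodConstructionAtWeilType`: the level-`n'` family `f : 𝒳 ⟶ S` through `(P, ψ₀, h_K)` with a GLOBAL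
endomorphism `g` inducing `ψ₀` and the fibrewise `√-d`, integral level structure with monodromy `≡ 1 (mod n')`, `n' ≥ 3`, period
surjectivity [U] and the polarization class `a'`) yields `PeriodPackage`: the flat `(n,n)` Weil-valued sections come from the tree's
chain balanced charts (`balancedCharts_of_constructionAt`) ▸ special-unitary monodromy (`unitaryMonodromy_of_levelStructureAt`) ▸
flat sections (`flatWeilSections_of_unitaryMonodromyAt`); the polarization class is `H := (ι ≫ pr₁)^* a'`, fibrewise rational of type
`(1,1)` (classes of `ℙᴺ` are algebraic); [U] is verbatim. [cite: Deligne1982HodgeCycles, §4 Prop. 4.4 and proof of Thm. 4.8 (pp. 47–52)]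
[cite: vanGeemen1994HodgeAV, 5.8–5.11] [cite: VoisinHodgeII2003, Lemma 4.17] -/
theorem periodPackage_of_deligne1982_weilFamily_periodConstructionAtWeilType
    (hJ : deligne1982_weilFamily_periodConstructionAtWeilType) : PeriodPackage := by
  intro n d hn hd P ψ₀ e a hP ha ha0 hWT
  have hn0 : 0 < n := hn
  have hd0 : 0 < d := hd
  have hψ : ψ₀ ≫ ψ₀ = -(d • 𝟙 P) := hWT.sq_eq
  have hψℤ : ψ₀ ≫ ψ₀ = -((d : ℤ) • 𝟙 P) := by rw [natCast_zsmul]; exact hψ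
  obtain ⟨𝒳, S, f, g, s₀, e', Y, Ψ, ε, N, ι, a', hfam, hιci, hιf, hirr, hsm, hqp, hg, he', hfib, hlev, hPer, ha', hH₀⟩ :=
    hJ n d hn hd P ψ₀ e a hP hψℤ ha ha0 hWT
  -- balanced charts, special-unitary monodromy, flat `(n,n)` Weil-valued sections: the tree's chain, verbatim
  obtain ⟨c, hcW, hc0, -⟩ := exists_isRationalClass_ne_zero_mem_weilClassesOf hWT.pos hWT.dim_eq hWT.d_pos hWT.sq_eq
  have hcH := hWT.isOfHodgeType_of_mem_weilClassesOf hcW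
  have hbalP := finrank_eq_of_mem_weilClassesOf hn0 hP hd0 hψ hcW hc0 hcH
  have hbal := balancedCharts_of_constructionAt hn0 hd0 hP hψ hbalP f g e' Y Ψ ε hfam ⟨N, ι, hιci, hιf⟩ hirr hsm hqp hg
    he' hfib
  have hdet := unitaryMonodromy_of_levelStructureAt hd0 hψ f g e' hg he' hlev
  have hsec := flatWeilSections_of_unitaryMonodromyAt hn0 hd0 hP hψ f g e' Y Ψ ε hfam hirr hsm hqp hg he'
    (fun s ↦ ⟨(hfib s).1, (hfib s).2.1, (hfib s).2.2, hbal s⟩) hdet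
  -- the polarization class `H := (ι ≫ pr₁)^* a'` is fibrewise rational of type `(1,1)`
  have hPN : IsSmoothProjective N (projectiveSpace N ℂ) := isSmoothProjective_projectiveSpace' N
  have ha'11 : IsOfHodgeType N (projectiveSpace N ℂ) (2 * 1) 1 1 a' :=
    isOfHodgeType_of_mem_algebraicClasses_of_isSmoothProjective hPN 1
      (by rw [algebraicClasses_projectiveSpace_eq_top]; exact Submodule.mem_top)
  refine ⟨𝒳, S, f, s₀, e', Y, Ψ, ε,
    complexBetti.map (ι ≫ CategoryTheory.CartesianMonoidalCategory.fst (projectiveSpace N ℂ) S) 2 a',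
    hfam, ⟨N, ι, hιci, hιf⟩, hirr, hsm, hqp, fun s ↦ ⟨(hfib s).1, (hfib s).2.1⟩, hsec, fun s ↦ ?_, hH₀, hPer⟩
  have hHs : complexBetti.map (fiberι f s) 2
      (complexBetti.map
        (ι ≫ CategoryTheory.CartesianMonoidalCategory.fst (projectiveSpace N ℂ) S) 2 a') =
      complexBetti.map
        (fiberι f s ≫ ι ≫ CategoryTheory.CartesianMonoidalCategory.fst (projectiveSpace N ℂ) S)
        2 a' := by
    rw [complexBetti.map_comp (fiberι f s), ModuleCat.comp_apply]
  rw [hHs]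
  exact ⟨ha'.map _, ha'11.map_of_isSmoothProjective (hfam.isSmoothProjective s) hPN _⟩

/-- **(J1) ⟹ the registered stub's statement `ModuliCompletePackage`** (weaken [U] to realisable periods). So the remaining stub
`stub_moduliComplete` of line `moduli-riemann` is AT MOST the one named, printed, unproved Literature fact (J1).
[cite: Deligne1982HodgeCycles, §4 proof of Thm. 4.8 (pp. 47–52)] -/
theorem moduliCompletePackage_of_deligne1982_weilFamily_periodConstructionAtWeilType
    (hJ : deligne1982_weilFamily_periodConstructionAtWeilType) : ModuliCompletePackage := by
  intro n d hn hd P ψ₀ e a hP ha ha0 hWT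
  obtain ⟨𝒳, S, f, s₀, e', Y, Ψ, ε, H, h1, h2, h3, h4, h5, h6, h7, h8, h9, m, hm, hPm, hd', hψ, ω, hω, hω0, hU⟩ :=
    periodPackage_of_deligne1982_weilFamily_periodConstructionAtWeilType hJ n d hn hd P ψ₀ e a hP ha ha0 hWT
  exact ⟨𝒳, S, f, s₀, e', Y, Ψ, ε, H, h1, h2, h3, h4, h5, h6, h7, h8, h9, m, hm, hPm, hd', hψ, ω, hω, hω0,
    fun J hW _ => hU J hW⟩

end Summit.HodgeConjecture.HodgeConjecture.Theorems

end
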